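import Summits.BirchSwinnertonDyer.BirchSwinnertonDyer.Theorems.PrintCFramBottomClassIndexLawFiveLeFlipRungLowerSlash
import Summits.BirchSwinnertonDyer.BirchSwinnertonDyer.Theorems.PrintCFramBottomClassIndexLawFiveLeFlipRungSlashCoeff
import Summits.BirchSwinnertonDyer.BirchSwinnertonDyer.Theorems.PrintCFramBottomClassIndexLawFiveLeFlipRungTransportReading
import HarnessLib

set_option autoImplicit false

/-!
# Crux `PrintCFram.BottomClassIndexLawFiveLe` (stmt-BirchSwinnertonDyer-20372), line `eisenstein-resource-bdp-line` (registry v28):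
# T8 «THE LOWER-UNIPOTENT RUNG», piece T8-2/3 file 2/2 — (D') THE COEFFICIENT OF `e(q·u·z)` AT A LOWER UNIPOTENT + THE NF-Q SOCKET
# (cell `bsd-print-cfram`, width seat `bsd-line-cfram-p1-w5` g8; THEOREMS ONLY, `--supports` 20372; BSD is not proved by any of this)

HONEST FRAMING. Pure bookkeeping about `q`-series; nothing here is a statement about elliptic curves, Bernoulli numbers or BSD; no
registered stub is closed. Sequel of `…FlipRungLowerSlash` ((A') decomposition, (B') main term, (C') junk periodicity): here the three are
combined into THE COEFFICIENT COROLLARY that T4's reading socket (`norm_ratCast_le_inv_of_coeff_eq_unit_mul`, w3 g19) and the T8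
assembly consume — the lower-unipotent twin of T3 (D) `coeff_flippedCusp_eq` (w4 g19), whose §1 tools (`eq_zero_of_hasSum_qParam`,
`qParam_vadd_of_period`) are reused by import.

* **`coeff_lowerUnipotent_eq`** — (D'): if `(V ∣_k γ)(z) = Σ_K g(K) e(Kz/H₁)` for a period `H₁ ≥ 1` (T4 takes `H₁ = N`, the `Γ(N)`-level
  of the vehicle, via `hasSum_qExpansion_slash_of_gamma1`), then for every `u` with `q ∤ u`: **`g(q·u·H₁) = q⁻²·c₀(q·u)·S'(q·u)`**,
  `S'(n) = Σ_{q ∤ 1+jC} h(j) e(n·h'(j)/q²)`. Mechanism: by (A') `V ∣_k γ = q⁻²·MAIN + JUNK`; by (B') `MAIN` is a series in `e(z) = e(H₁z/H₁)`;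
  by (C') `JUNK(z + 1/q²) = JUNK(z)`, so its coefficients `j(K)` satisfy `j(K)·(e(K/(q²H₁)) − 1) = 0`, and `e(quH₁/(q²H₁)) = e(u/q) ≠ 1`
  for `q ∤ u`. NO vanishing of `S'` off the multiples of `q` and NO holomorphy or boundedness of the junk is used.
* §2 `qExpansion_coeff_lowerUnipotent_eq` — (D') read on Mathlib's `qExpansion N (⇑V ∣_k γ)` for `V : ModularForm (Gamma1 L) k`, `L ∣ N`
  (T4's `hasSum_qExpansion_slash_of_gamma1`), and **`exists_isIntegral_lowerUnipotent_coeff`** — THE PER-CUSP NF-Q MEMBERSHIP SOCKET: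
  under NF-Q (hypothesis) and the single-class hypothesis «every coefficient of `qExpansion 1 V` lies in `p·ℤ̄[1/N]`»,
  **`q⁻²·c₀(q·u)·S'(q·u) ∈ p·ℤ̄[1/N]`** for every `u` with `q ∤ u` (T8-2/3 ∘ T8-4 = w3 g19's `exists_isIntegral_qExpansion_slash_coeff`).
* §3 `exists_int_dvd_and_cast_eq[_sq]` — the CRT choice of `C` per cusp: `M ∣ C` with `C ≡ t (mod q²)` for any `t`, `q ∤ M`.
With T8-1a (w6 g9: `S'(qu) = ψ_{q²}(t⁻¹(qv+qu))·q·K_{−t̄}(u,v)` for the single-class weights `h(j) = ψ_{q²}(−qv·j)`) this is, cusp by cusp, the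
`hK` family of T8-1b's reading `norm_ratCast_le_inv_of_kloosterman_memberships_twisted` (w3 g19), whose trace over the units `t` and
pigeonhole (Raum's Lemma 2.4 over `ℤ`) give `‖c₀(qu)‖_p ≤ p⁻¹` on EVERY class `qu` (w3g19 §2 (U5)–(U6)). beyond-print theorem: NO.

References: [Raum 2023] arXiv:2105.13170, proof of Prop. 2.3 (pp. 22–24); [Shimura1971] Prop. 3.64; [DiamondShurman2005] §1.1–1.2;
[Katz1973] §1.6 Cor. 1.6.2 (the consumer's named fact NF-Q, hypothesis of §2).
-/

-- summit-side namespace `Summit.BirchSwinnertonDyer.BirchSwinnertonDyer.…` (single-conjunct summit, D-0017 layout)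
set_option linter.dupNamespace false

noncomputable section

open scoped MatrixGroups ModularForm Real Classical Topology
open UpperHalfPlane hiding I
open Complex Matrix.GeneralLinearGroup CongruenceSubgroup Function Filter
open Literature.NumberTheory.EllipticCurves.ModularForms (slash_upperRightHom_apply upperRightHom_smul qParam_vadd)

namespace Summit.BirchSwinnertonDyer.BirchSwinnertonDyer.Theorems.PrintCFram.FlipRung

/-! ## §1 (D') The coefficient of `e(q·u·z)`, `q ∤ u`, in `V ∣_k γ` -/

/-- **(D') THE COEFFICIENT COROLLARY AT A LOWER UNIPOTENT.** Setting of `slash_lowerUnipotent_decomposition` (`q ≥ 1`;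
`γ = [1 0; q²C 1] ∈ SL₂(ℤ)` with `M ∣ C`; the weight-`k` vehicle `F₀`, invariant under every `γ' ∈ SL₂(ℤ)` with `Mq² ∣ γ'₁₀`,
`M ∣ γ'₁₁ − 1`, with `F₀(τ) = Σ c₀(n) e(nτ)`; weights `h`; the twisted form `V(z) = q⁻² Σ_j h(j) F₀(z + j/q²)`; solutions `h', e` of
`(1 + jC)·h'(j) = j + q²·e(j)` at the good translates). Suppose `(V ∣_k γ)(z) = Σ_K g(K) e(K z/H₁)` on `ℍ` for a period `H₁ ≥ 1`
(T4: `H₁ = N`, via `hasSum_qExpansion_slash_of_gamma1`). Then for every `u` with `q ∤ u`: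
**`g(q·u·H₁) = q⁻² · c₀(q·u) · S'(q·u)`**, `S'(n) = Σ_{j good} h(j) e(n·h'(j)/q²)`. No analytic hypothesis on the junk is used: it is
`(1/q²)`-periodic ((C')) and has the expansion `(V ∣_k γ) − q⁻²·MAIN`, so its coefficients vanish off the `K` with `e(K/(q²H₁)) = 1`,
and `e(q u H₁/(q² H₁)) = e(u/q) ≠ 1`. (Raum: «their contributions later in the proof will vanish».)
[cite: Shimura1971, Prop. 3.64] [cite: DiamondShurman2005, §1.1 and §1.2] -/
theorem coeff_lowerUnipotent_eq {q : ℕ} [NeZero (q ^ 2)] (hq : q ≠ 0) (γ : SL(2, ℤ)) {M C : ℤ} (hMC : M ∣ C)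
    (h00 : γ 0 0 = 1) (h01 : γ 0 1 = 0) (h10 : γ 1 0 = (q : ℤ) ^ 2 * C) (h11 : γ 1 1 = 1)
    {k : ℤ} (F₀ : ℍ → ℂ)
    (hinv : ∀ γ' : SL(2, ℤ), M * (q : ℤ) ^ 2 ∣ γ' 1 0 → M ∣ γ' 1 1 - 1 → F₀ ∣[k] γ' = F₀)
    (c₀ : ℕ → ℂ) (hF₀ : ∀ τ : ℍ, HasSum (fun n : ℕ ↦ c₀ n * Periodic.qParam 1 (τ : ℂ) ^ n) (F₀ τ))
    (h : ZMod (q ^ 2) → ℂ) (V : ℍ → ℂ)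
    (hV : ∀ z : ℍ, V z = ((q : ℂ) ^ 2)⁻¹ * ∑ j : ZMod (q ^ 2), h j * F₀ (((j.val : ℝ) / (q : ℝ) ^ 2) +ᵥ z))
    (h' e : ZMod (q ^ 2) → ℤ)
    (hhe : ∀ j : ZMod (q ^ 2), ¬ (q : ℤ) ∣ 1 + (j.val : ℤ) * C →
      (1 + (j.val : ℤ) * C) * h' j = (j.val : ℤ) + (q : ℤ) ^ 2 * e j)
    {H₁ : ℕ} (hH₁ : 0 < H₁) (g : ℕ → ℂ)
    (hG : ∀ z : ℍ, HasSum (fun K : ℕ ↦ g K * Periodic.qParam (H₁ : ℝ) (z : ℂ) ^ K) ((V ∣[k] γ) z))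
    (u : ℕ) (hu : ¬ q ∣ u) :
    g (q * u * H₁) = ((q : ℂ) ^ 2)⁻¹ * c₀ (q * u) *
      ∑ j ∈ Finset.univ.filter (fun j : ZMod (q ^ 2) ↦ ¬ (q : ℤ) ∣ 1 + (j.val : ℤ) * C),
        h j * cexp (2 * π * I * ((h' j : ℂ) / (q : ℂ) ^ 2) * (q * u : ℕ)) := by
  have hqR : (0 : ℝ) < q := by exact_mod_cast Nat.pos_of_ne_zero hq
  have hH : (0 : ℝ) < (H₁ : ℝ) := by exact_mod_cast hH₁
  -- notation: the character sum, the constant, the coefficient sequence of the main term in `e(·/H₁)`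
  set S : ℕ → ℂ := fun n ↦ ∑ j ∈ Finset.univ.filter (fun j : ZMod (q ^ 2) ↦ ¬ (q : ℤ) ∣ 1 + (j.val : ℤ) * C),
    h j * cexp (2 * π * I * ((h' j : ℂ) / (q : ℂ) ^ 2) * n) with hSdef
  set Cst : ℂ := ((q : ℂ) ^ 2)⁻¹ with hCdef
  set m : ℕ → ℂ := fun K ↦ if H₁ ∣ K then c₀ (K / H₁) * S (K / H₁) else 0 with hmdef
  -- the main value and the junk as functions of `z`
  set MAIN : ℍ → ℂ := fun z ↦ ∑ j ∈ Finset.univ.filter (fun j : ZMod (q ^ 2) ↦ ¬ (q : ℤ) ∣ 1 + (j.val : ℤ) * C),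
    h j * F₀ (((h' j : ℝ) / (q : ℝ) ^ 2) +ᵥ z) with hMAINdef
  set JUNK : ℍ → ℂ := fun z ↦ ((q : ℂ) ^ 2)⁻¹ *
    ∑ j ∈ Finset.univ.filter (fun j : ZMod (q ^ 2) ↦ (q : ℤ) ∣ 1 + (j.val : ℤ) * C),
      h j * (F₀ ∣[k] (upperRightHom ((j.val : ℝ) / (q : ℝ) ^ 2) * (γ : GL (Fin 2) ℝ))) z with hJUNKdef
  -- (A'): `V ∣ γ = Cst · MAIN + JUNK`
  have hA : ∀ z : ℍ, (V ∣[k] γ) z = Cst * MAIN z + JUNK z := fun z ↦ by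
    rw [slash_lowerUnipotent_decomposition hq γ hMC h00 h01 h10 h11 F₀ hinv h V hV h' e hhe z]
  -- (B') re-indexed: `MAIN(z) = Σ_K m(K) e(Kz/H₁)`
  have hB : ∀ z : ℍ, HasSum (fun K : ℕ ↦ m K * Periodic.qParam (H₁ : ℝ) (z : ℂ) ^ K) (MAIN z) := by
    intro z
    have hB0 := hasSum_translates_mainTerm F₀ c₀ hF₀
      (Finset.univ.filter (fun j : ZMod (q ^ 2) ↦ ¬ (q : ℤ) ∣ 1 + (j.val : ℤ) * C)) h h' z
    -- `e(n z) = e(n H₁ z/H₁)` : pass to `K = n H₁`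
    have hinj : Injective (fun n : ℕ ↦ n * H₁) := fun a b hab ↦ Nat.eq_of_mul_eq_mul_right hH₁ hab
    refine (hinj.hasSum_iff ?_).mp ?_
    · intro K hK
      have hK' : ¬ H₁ ∣ K := by
        rintro ⟨t, rfl⟩; exact hK ⟨t, by ring⟩
      show m K * Periodic.qParam (H₁ : ℝ) (z : ℂ) ^ K = 0
      rw [hmdef]; simp only [if_neg hK', zero_mul]
    · refine hB0.congr_fun fun n ↦ ?_
      have hm : m (n * H₁) = c₀ n * S n := by
        rw [hmdef]; simp only [if_pos (dvd_mul_left H₁ n), Nat.mul_div_cancel n hH₁]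
      simp only [Function.comp_apply]
      rw [hm]
      congr 1
      rw [Periodic.qParam, Periodic.qParam, ← Complex.exp_nat_mul, ← Complex.exp_nat_mul]
      congr 1
      have hH₁C : (H₁ : ℂ) ≠ 0 := by exact_mod_cast hH₁.ne'
      push_cast
      field_simp
  -- the junk has the expansion `g − Cst·m` …
  have hJ : ∀ z : ℍ, HasSum (fun K : ℕ ↦ (g K - Cst * m K) * Periodic.qParam (H₁ : ℝ) (z : ℂ) ^ K) (JUNK z) := by
    intro z
    have h1 : JUNK z = (V ∣[k] γ) z - Cst * MAIN z := by rw [hA z]; ring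
    rw [h1]
    have h2 := (hG z).sub ((hB z).mul_left Cst)
    refine h2.congr_fun fun K ↦ ?_
    ring
  -- … and is `(1/q²)`-periodic ((C')), so `(g K − Cst m K)·(e(K/(q²H₁)) − 1) = 0`
  have hJper : ∀ z : ℍ, JUNK (((((q : ℝ) ^ 2)⁻¹) +ᵥ z : ℍ)) = JUNK z := by
    intro z
    simp only [hJUNKdef]
    congr 1
    refine Finset.sum_congr rfl fun j hj ↦ ?_
    rw [Finset.mem_filter] at hj
    congr 1
    rw [← slash_upperRightHom_apply (F₀ ∣[k] (upperRightHom ((j.val : ℝ) / (q : ℝ) ^ 2) * (γ : GL (Fin 2) ℝ))) k,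
      slash_translate_lowerUnipotent_periodic_of_dvd hq γ hMC h00 h01 h10 h11 F₀ hinv hj.2]
  have hvanish : ∀ K : ℕ, (g K - Cst * m K) * (cexp (2 * π * I * ((q : ℝ) ^ 2)⁻¹ / (H₁ : ℝ) * K) - 1) = 0 := by
    have hzero : ∀ z : ℍ, HasSum (fun K : ℕ ↦ ((g K - Cst * m K) * (cexp (2 * π * I * ((q : ℝ) ^ 2)⁻¹ / (H₁ : ℝ) * K) - 1)) *
        Periodic.qParam (H₁ : ℝ) (z : ℂ) ^ K) 0 := by
      intro z
      have h1 := hJ (((((q : ℝ) ^ 2)⁻¹) +ᵥ z : ℍ))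
      rw [hJper z] at h1
      have h2 := h1.sub (hJ z)
      rw [sub_self] at h2
      refine h2.congr_fun fun K ↦ ?_
      rw [qParam_vadd_of_period, mul_pow, ← Complex.exp_nat_mul]
      push_cast
      ring
    intro K
    exact eq_zero_of_hasSum_qParam hH hzero K
  -- at `K = q u H₁` the exponential is `e(u/q) ≠ 1`
  have hexp : cexp (2 * π * I * ((q : ℝ) ^ 2)⁻¹ / (H₁ : ℝ) * (q * u * H₁ : ℕ)) ≠ 1 := by
    intro h1
    rw [Complex.exp_eq_one_iff] at h1
    obtain ⟨n, hn⟩ := h1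
    have hqC : (q : ℂ) ≠ 0 := by exact_mod_cast hq
    have hH₁C : (H₁ : ℂ) ≠ 0 := by exact_mod_cast hH₁.ne'
    have hπ : (2 * π * I : ℂ) ≠ 0 := by simp [Real.pi_ne_zero, Complex.I_ne_zero]
    have key : ((u : ℤ) : ℂ) = (n * q : ℤ) := by
      have e1 : 2 * π * I * ((q : ℝ) ^ 2)⁻¹ / (H₁ : ℝ) * (q * u * H₁ : ℕ) = (u : ℂ) / q * (2 * π * I) := by
        push_cast; field_simp
      rw [e1] at hn
      have e2 := mul_right_cancel₀ hπ hn
      push_cast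
      field_simp at e2
      linear_combination e2
    have key' : (u : ℤ) = n * q := by exact_mod_cast key
    exact hu ⟨n.natAbs, by
      have := congrArg Int.natAbs key'
      simpa [Int.natAbs_mul, Int.natAbs_natCast, mul_comm] using this⟩
  have hK := hvanish (q * u * H₁)
  rw [mul_eq_zero, sub_eq_zero] at hK
  rcases hK with hK | hK
  · rw [hK, hmdef]
    simp only [if_pos (dvd_mul_left H₁ (q * u)), Nat.mul_div_cancel (q * u) hH₁, hSdef, hCdef]
    ring
  · exact absurd (sub_eq_zero.mp hK) hexp

/-! ## §2 (D') in Mathlib's `qExpansion N` currency and THE PER-CUSP NF-Q MEMBERSHIP SOCKET -/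

/-- **(D') on `qExpansion N (V ∣_k γ)`.** For a modular form `V` of weight `k` on `Γ₁(L)`, `L ∣ N`, `N ≥ 1`, whose underlying function is the
twisted form `q⁻² Σ_j h(j) F₀(· + j/q²)` of the setting of `coeff_lowerUnipotent_eq`, the coefficient of index `q·u·N` (frequency `e(q·u·z)`) of
Mathlib's `qExpansion N (⇑V ∣_k γ)` at the lower unipotent `γ = [1 0; q²C 1]` is `q⁻² · c₀(q·u) · S'(q·u)` for every `u` with `q ∤ u`
(the `HasSum` representation is T4's `hasSum_qExpansion_slash_of_gamma1`, w3 g19). [cite: DiamondShurman2005, §1.1 and §1.2] -/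
theorem qExpansion_coeff_lowerUnipotent_eq {q : ℕ} [NeZero (q ^ 2)] (hq : q ≠ 0) (γ : SL(2, ℤ)) {M C : ℤ} (hMC : M ∣ C)
    (h00 : γ 0 0 = 1) (h01 : γ 0 1 = 0) (h10 : γ 1 0 = (q : ℤ) ^ 2 * C) (h11 : γ 1 1 = 1)
    {k : ℤ} {L N : ℕ} [NeZero N] (hLN : L ∣ N) (V : ModularForm (Gamma1 L) k) (F₀ : ℍ → ℂ)
    (hinv : ∀ γ' : SL(2, ℤ), M * (q : ℤ) ^ 2 ∣ γ' 1 0 → M ∣ γ' 1 1 - 1 → F₀ ∣[k] γ' = F₀)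
    (c₀ : ℕ → ℂ) (hF₀ : ∀ τ : ℍ, HasSum (fun n : ℕ ↦ c₀ n * Periodic.qParam 1 (τ : ℂ) ^ n) (F₀ τ))
    (h : ZMod (q ^ 2) → ℂ)
    (hV : ∀ z : ℍ, (⇑V : ℍ → ℂ) z = ((q : ℂ) ^ 2)⁻¹ * ∑ j : ZMod (q ^ 2), h j * F₀ (((j.val : ℝ) / (q : ℝ) ^ 2) +ᵥ z))
    (h' e : ZMod (q ^ 2) → ℤ)
    (hhe : ∀ j : ZMod (q ^ 2), ¬ (q : ℤ) ∣ 1 + (j.val : ℤ) * C →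
      (1 + (j.val : ℤ) * C) * h' j = (j.val : ℤ) + (q : ℤ) ^ 2 * e j)
    (u : ℕ) (hu : ¬ q ∣ u) :
    (qExpansion N (⇑V ∣[k] γ)).coeff (q * u * N) = ((q : ℂ) ^ 2)⁻¹ * c₀ (q * u) *
      ∑ j ∈ Finset.univ.filter (fun j : ZMod (q ^ 2) ↦ ¬ (q : ℤ) ∣ 1 + (j.val : ℤ) * C),
        h j * cexp (2 * π * I * ((h' j : ℂ) / (q : ℂ) ^ 2) * (q * u : ℕ)) := by
  have hN : 0 < N := Nat.pos_of_ne_zero (NeZero.ne N)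
  have hG : ∀ z : ℍ, HasSum (fun K : ℕ ↦ (qExpansion N (⇑V ∣[k] γ)).coeff K * Periodic.qParam (N : ℝ) (z : ℂ) ^ K)
      ((⇑V ∣[k] γ) z) := fun z ↦ by
    simpa only [smul_eq_mul] using hasSum_qExpansion_slash_of_gamma1 hLN V γ z
  exact coeff_lowerUnipotent_eq hq γ hMC h00 h01 h10 h11 F₀ hinv c₀ hF₀ h (⇑V) hV h' e hhe hN _ hG u hu

/-- **THE PER-CUSP NF-Q MEMBERSHIP SOCKET OF THE LOWER-UNIPOTENT RUNG** (T8-2/3 ∘ T8-4; what the modular assembly calls once per cusp `γ_t`).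
NF-Q (Katz 1973 Cor. 1.6.2, hypothesis), `V` a modular form of weight `k` on `Γ₁(L)`, `L ∣ N`, `3 ≤ N`, with EVERY coefficient of `qExpansion 1 V` in
`p·ℤ̄[1/N]` (the single-class hypothesis at `∞`) and underlying function the twisted form of the setting of `coeff_lowerUnipotent_eq`; then for
every `u` with `q ∤ u`: **`q⁻² · c₀(q·u) · S'(q·u) ∈ p·ℤ̄[1/N]`** — NF-Q at the coefficient `q·u·N` of the cusp `γ·∞` (w3 g19's
`exists_isIntegral_qExpansion_slash_coeff`) combined with (D'). With T8-1a (w6 g9: `S'(qu) = ψ_{q²}(t⁻¹(qv+qu))·q·K_{−t̄}(u,v)` for the single-class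
weights) this is, cusp by cusp, the `hK` family of T8-1b's reading `norm_ratCast_le_inv_of_kloosterman_memberships_twisted` (w3 g19).
CONDITIONAL on NF-Q (hypothesis). [cite: Katz1973, §1.6 Cor. 1.6.2] -/
theorem exists_isIntegral_lowerUnipotent_coeff
    (hKatz : Literature.NumberTheory.ModularForms.Katz1973_qExpansionPrinciple_allCusps)
    {q : ℕ} [NeZero (q ^ 2)] (hq : q ≠ 0) (γ : SL(2, ℤ)) {M C : ℤ} (hMC : M ∣ C)
    (h00 : γ 0 0 = 1) (h01 : γ 0 1 = 0) (h10 : γ 1 0 = (q : ℤ) ^ 2 * C) (h11 : γ 1 1 = 1)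
    {k : ℤ} {L N : ℕ} (hLN : L ∣ N) (hN : 3 ≤ N) (V : ModularForm (Gamma1 L) k) (p : ℕ)
    (hcoef : ∀ n : ℕ, ∃ y : ℂ, (∃ j : ℕ, IsIntegral ℤ ((N : ℂ) ^ j * y)) ∧ (qExpansion 1 ⇑V).coeff n = (p : ℂ) * y)
    (F₀ : ℍ → ℂ)
    (hinv : ∀ γ' : SL(2, ℤ), M * (q : ℤ) ^ 2 ∣ γ' 1 0 → M ∣ γ' 1 1 - 1 → F₀ ∣[k] γ' = F₀)
    (c₀ : ℕ → ℂ) (hF₀ : ∀ τ : ℍ, HasSum (fun n : ℕ ↦ c₀ n * Periodic.qParam 1 (τ : ℂ) ^ n) (F₀ τ))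
    (h : ZMod (q ^ 2) → ℂ)
    (hV : ∀ z : ℍ, (⇑V : ℍ → ℂ) z = ((q : ℂ) ^ 2)⁻¹ * ∑ j : ZMod (q ^ 2), h j * F₀ (((j.val : ℝ) / (q : ℝ) ^ 2) +ᵥ z))
    (h' e : ZMod (q ^ 2) → ℤ)
    (hhe : ∀ j : ZMod (q ^ 2), ¬ (q : ℤ) ∣ 1 + (j.val : ℤ) * C →
      (1 + (j.val : ℤ) * C) * h' j = (j.val : ℤ) + (q : ℤ) ^ 2 * e j)
    (u : ℕ) (hu : ¬ q ∣ u) :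
    ∃ y : ℂ, (∃ j : ℕ, IsIntegral ℤ ((N : ℂ) ^ j * y)) ∧
      ((q : ℂ) ^ 2)⁻¹ * c₀ (q * u) *
        ∑ j ∈ Finset.univ.filter (fun j : ZMod (q ^ 2) ↦ ¬ (q : ℤ) ∣ 1 + (j.val : ℤ) * C),
          h j * cexp (2 * π * I * ((h' j : ℂ) / (q : ℂ) ^ 2) * (q * u : ℕ)) = (p : ℂ) * y := by
  haveI : NeZero N := ⟨by omega⟩
  obtain ⟨y, hy, hK⟩ := exists_isIntegral_qExpansion_slash_coeff hKatz hLN hN V p hcoef γ (q * u * N)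
  exact ⟨y, hy, by rw [← qExpansion_coeff_lowerUnipotent_eq hq γ hMC h00 h01 h10 h11 hLN V F₀ hinv c₀ hF₀ h hV h' e hhe u hu, hK]⟩

/-! ## §3 The choice of `C` per cusp: `M ∣ C` with prescribed residue mod `q²` (CRT) -/

/-- **CRT for the lower unipotent.** If `M` is prime to `n`, every residue `t ∈ ℤ/n` is represented by an integer `C` with `M ∣ C`
(`C = M · (M̄⁻¹ t)`). The assembly uses it with `n = q²` to realise every Kloosterman index `t` by a cusp `γ_t = [1 0; q²C 1]` with `M ∣ C`.
[folklore] -/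
theorem exists_int_dvd_and_cast_eq {n : ℕ} [NeZero n] {M : ℤ} (hM : IsCoprime (n : ℤ) M) (t : ZMod n) :
    ∃ C : ℤ, M ∣ C ∧ (C : ZMod n) = t := by
  have hu : IsUnit (M : ZMod n) := (ZMod.coe_int_isUnit_iff_isCoprime M n).mpr hM
  obtain ⟨w, hw⟩ := hu
  refine ⟨M * ((((w⁻¹ : (ZMod n)ˣ) : ZMod n) * t).val : ℤ), dvd_mul_right _ _, ?_⟩
  push_cast
  rw [ZMod.natCast_zmod_val, ← hw, ← mul_assoc, Units.mul_inv, one_mul]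

/-- **CRT for the lower unipotent, prime-square modulus.** For a prime `q` and `M` with `q ∤ M`, every `t ∈ ℤ/q²` is `C mod q²` for some
integer `C` with `M ∣ C`. [folklore] -/
theorem exists_int_dvd_and_cast_eq_sq {q : ℕ} (hq : q.Prime) {M : ℤ} (hM : ¬ (q : ℤ) ∣ M) (t : ZMod (q ^ 2)) :
    ∃ C : ℤ, M ∣ C ∧ (C : ZMod (q ^ 2)) = t := by
  haveI : NeZero (q ^ 2) := ⟨pow_ne_zero 2 hq.ne_zero⟩
  have hcop : IsCoprime ((q ^ 2 : ℕ) : ℤ) M := by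
    push_cast
    exact (((Nat.prime_iff_prime_int.mp hq).irreducible.coprime_iff_not_dvd).mpr hM).pow_left
  exact exists_int_dvd_and_cast_eq hcop t

end Summit.BirchSwinnertonDyer.BirchSwinnertonDyer.Theorems.PrintCFram.FlipRung

end
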